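import Literature.NumberTheory.Sieve.FriedlanderIwaniecPrimesPoisson
import Mathlib.MeasureTheory.Integral.Prod
import HarnessLib

/-!
# Poisson summation over a lattice coset in the plane, and Fourier bounds by partial integration (toolkit for FI §6)

Family `parity`, statement parity.S17; analytic toolkit for J. Friedlander, H. Iwaniec, *The
polynomial `X² + Y⁴` captures its primes*, Ann. of Math. (2) 148 (1998), 945–1040
[FriedlanderIwaniecAnnals1998], §6 "Counting points inside a biquadratic ellipse", (6.7)–(6.9):
"Next we split the summation into residue classes modulo `|Δ|` … Then for each pair of classes we
execute the summation by Poisson's formula obtaining for `C(z₁, z₂; γ₁, γ₂)` the Fourier series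
`|Δ|⁻¹|z₁z₂|^{-1/2} ΣΣ F(h₁|Δz₂|^{-1/2}, h₂|Δz₁|^{-1/2}) e((γ₁h₁ + γ₂h₂)|Δ|⁻¹)`", and §7 "If
`u₁ ≠ 0` we can integrate by parts four times …" (here: twice in each variable).

Everything is standard analysis on `ℝ²`, PROVED from the one-dimensional toolkit
`FriedlanderIwaniecPrimesPoisson` (Poisson along arithmetic progressions, `(2π|ξ|)ⁿ|𝓕F(ξ)| ≤ ∫|F⁽ⁿ⁾|`)
and Mathlib (Fubini for continuous compactly supported functions, continuity of parametric
integrals, `Real.fourier_iteratedDeriv`). The two-dimensional transform is taken ITERATED,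
`Φ̂(ξ₁, ξ₂) = 𝓕_{t₁}(𝓕_{t₂}Φ)(ξ₁, ξ₂)` (`fourier2`), which is all the Poisson formula needs; Fubini
identifies it with the other order (`fourier2_eq_swap`). Hypotheses are phrased for
`Φ : ℝ → ℝ → ℂ` continuous, vanishing off a box `[-R, R]²` (`BoxSupport`), with smooth slices;
second partial derivatives enter as explicitly given functions `Θ` with
`iteratedDeriv 2 (slice) = Θ-slice` (the consumer computes them in closed form).

## Contents

* `tsum_arithProg_eq_tsum_fourier_of_decay` — Poisson along `a ≡ α (mod d)` for `F` continuous of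
  compact support with `𝓕F = O(|ξ|⁻²)` (the smoothness-free variant of the toolkit lemma);
  `tendsto_div_const_cocompact`, `summable_fourier_div_of_decay`.
* `BoxSupport` and slice facts; `ker v w = e(-vw)`, `fourier_eq_integral_ker`; `sliceFourier`
  (`Ψ_{ξ₂}(t₁) = 𝓕(Φ(t₁,·))(ξ₂)`), `fourier2` (`Φ̂`); `continuous_sliceFourier`,
  `hasCompactSupport_sliceFourier`, **`fourier2_eq_swap`** (Fubini).
* Bounds: `norm_fourier2_le` (`|Φ̂| ≤ ∫∫|Φ|`), `norm_fourier2_le_of_left` / `norm_fourier2_le_left`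
  (`|Φ̂| ≤ (2π|ξ₁|)⁻² ∫∫|∂₁²Φ|`), `norm_fourier2_le_right` (`(2π|ξ₂|)⁻² ∫∫|∂₂²Φ|`),
  `sliceFourier_eq_of_deriv`, `fourier2_eq_of_deriv`, **`norm_fourier2_le_mixed`**
  (`|Φ̂| ≤ (2π|ξ₁|)⁻²(2π|ξ₂|)⁻² ∫∫|∂₁²∂₂²Φ|`); `fourier_sliceFourier_isBigO`;
  `integrable_integral_norm_left/right`.
* **`tsum_tsum_arithProg₂`** — `Σ_{m₁} Σ_{m₂} Φ(γ₁ + Dm₁, γ₂ + Dm₂) =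
  D⁻² Σ_{k₂} Σ_{k₁} e((γ₁k₁ + γ₂k₂)/D) Φ̂(k₁/D, k₂/D)` ((6.7) ⇒ (6.9) of the source, one pair of
  classes at a time); `abs_gt_of_not_mem_Icc` (the `m₁`-sum is finite).
* `norm_tsum_tsum_sub_le` — splitting off the zero frequency of a dominated double series
  ((6.13): "Naturally the main contribution comes from `h₁ = h₂ = 0`").

## References

* J. Friedlander, H. Iwaniec, Ann. of Math. (2) 148 (1998), 945–1040, §6 (6.7)–(6.13), §7.
  [FriedlanderIwaniecAnnals1998]
* E. M. Stein, G. Weiss, *Introduction to Fourier Analysis on Euclidean Spaces*, Cor. VII.2.6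
  (Poisson summation, via Mathlib's `Real.tsum_eq_tsum_fourier_of_rpow_decay`).

## Mathlib

`Real.tsum_eq_tsum_fourier_of_rpow_decay`, `Real.fourier_iteratedDeriv`,
`Real.fourier_real_eq_integral_exp_smul`, `MeasureTheory.integral_integral_swap_of_hasCompactSupport`,
`continuous_parametric_integral_of_continuous`, `MeasureTheory.norm_setIntegral_le_of_norm_le_const`,
`MeasureTheory.integral_mono_of_nonneg`, `Summable.tsum_finsetSum`, `tsum_eq_sum`,
`summable_of_isBigO`, `Int.tendsto_coe_cofinite`, `cocompact_eq_atBot_atTop`, `tsum_of_norm_bounded`.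
-/

noncomputable section

open Real MeasureTheory Filter Complex Set
open scoped FourierTransform Topology ContDiff

namespace Literature.NumberTheory.Sieve.FriedlanderIwaniecPrimes

/-! ### Poisson summation along an arithmetic progression under a decay hypothesis -/

/-- `ξ ↦ ξ / d` tends to infinity with `ξ` (`d > 0`). [folklore] -/
theorem tendsto_div_const_cocompact {d : ℝ} (hd : 0 < d) :
    Tendsto (fun ξ : ℝ => ξ / d) (cocompact ℝ) (cocompact ℝ) := by
  rw [cocompact_eq_atBot_atTop]
  exact ((tendsto_id.atBot_div_const hd).mono_right le_sup_left).sup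
    ((tendsto_id.atTop_div_const hd).mono_right le_sup_right)

/-- **Poisson summation along `a ≡ α (mod d)`** for a continuous compactly supported `F : ℝ → ℂ`
whose Fourier transform decays like `|ξ|⁻²`:
`∑_{m ∈ ℤ} F(α + dm) = d⁻¹ ∑_{k ∈ ℤ} e(αk/d) 𝓕F(k/d)` (the variant of
`tsum_arithProg_eq_tsum_fourier` without smoothness). [folklore] -/
theorem tsum_arithProg_eq_tsum_fourier_of_decay {F : ℝ → ℂ} (hFc : Continuous F)
    (hFs : HasCompactSupport F) (hdec : 𝓕 F =O[cocompact ℝ] fun ξ : ℝ => |ξ| ^ (-2 : ℝ))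
    {d : ℕ} (hd : 0 < d) (α : ℤ) :
    ∑' m : ℤ, F (α + d * m) =
      (d : ℂ)⁻¹ * ∑' k : ℤ, (𝐞 ((α : ℝ) * k / d) : ℂ) * 𝓕 F ((k : ℝ) / d) := by
  have hdr : (0 : ℝ) < d := by exact_mod_cast hd
  set G : ℝ → ℂ := fun u => F (α + d * u) with hG
  have hGc : Continuous G := hFc.comp (continuous_const.add (continuous_const.mul continuous_id))
  have hGs : HasCompactSupport G := by
    have h := hFs.comp_homeomorph ((Homeomorph.mulLeft₀ (d : ℝ) hdr.ne').trans
      (Homeomorph.addLeft (α : ℝ)))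
    have hGeq : G = F ∘ ⇑((Homeomorph.mulLeft₀ (d : ℝ) hdr.ne').trans
        (Homeomorph.addLeft (α : ℝ))) := by
      funext u
      rfl
    rw [hGeq]
    exact h
  -- decay of `𝓕 G` from that of `𝓕 F`
  have hGdec : 𝓕 G =O[cocompact ℝ] fun ξ : ℝ => |ξ| ^ (-2 : ℝ) := by
    have h1 : 𝓕 G = fun ξ => ((d : ℝ) : ℂ)⁻¹ * (𝐞 (α * ξ / d) : ℂ) * 𝓕 F (ξ / d) := by
      funext ξ; rw [hG, fourier_comp_affine F hdr]
    have h2 : (fun ξ : ℝ => 𝓕 F (ξ / d)) =O[cocompact ℝ] fun ξ : ℝ => |ξ / d| ^ (-2 : ℝ) :=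
      hdec.comp_tendsto (tendsto_div_const_cocompact hdr)
    have h3 : (fun ξ : ℝ => |ξ / d| ^ (-2 : ℝ)) =O[cocompact ℝ] fun ξ : ℝ => |ξ| ^ (-2 : ℝ) := by
      refine Asymptotics.IsBigO.of_bound ((d : ℝ) ^ 2) ?_
      filter_upwards [(isCompact_singleton (x := (0 : ℝ))).compl_mem_cocompact] with ξ hξ
      have hξ0 : ξ ≠ 0 := fun h => hξ (by simp [h])
      have hξa : 0 < |ξ| := abs_pos.mpr hξ0
      rw [Real.norm_eq_abs, Real.norm_eq_abs, abs_of_pos (Real.rpow_pos_of_pos (by positivity) _),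
        abs_of_pos (Real.rpow_pos_of_pos hξa _), abs_div, abs_of_pos hdr,
        Real.div_rpow hξa.le hdr.le, Real.rpow_neg hdr.le, Real.rpow_two]
      rw [div_eq_mul_inv, inv_inv, mul_comm]
    have h4 : 𝓕 G =O[cocompact ℝ] fun ξ : ℝ => 𝓕 F (ξ / d) := by
      rw [h1]
      refine Asymptotics.IsBigO.of_bound ((d : ℝ)⁻¹) (Eventually.of_forall fun ξ => ?_)
      rw [norm_mul, norm_mul, Circle.norm_coe, mul_one, norm_inv, Complex.norm_real, Real.norm_eq_abs,
        abs_of_pos hdr]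
    exact h4.trans (h2.trans h3)
  -- Poisson summation for `G` at `x = 0`
  have hP := Real.tsum_eq_tsum_fourier_of_rpow_decay hGc one_lt_two
    (isBigO_cocompact_of_hasCompactSupport hGs _) hGdec 0
  simp only [zero_add, QuotientAddGroup.mk_zero, fourier_eval_zero, mul_one] at hP
  have hP' : ∑' n : ℤ, G n = ∑' n : ℤ, 𝓕 G n := hP
  calc ∑' m : ℤ, F (α + d * m) = ∑' n : ℤ, G n := rfl
    _ = ∑' n : ℤ, 𝓕 G n := hP'
    _ = ∑' k : ℤ, (d : ℂ)⁻¹ * ((𝐞 ((α : ℝ) * k / d) : ℂ) * 𝓕 F ((k : ℝ) / d)) := by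
        refine tsum_congr fun k => ?_
        rw [hG, fourier_comp_affine F hdr, mul_assoc]
        push_cast
        ring
    _ = (d : ℂ)⁻¹ * ∑' k : ℤ, (𝐞 ((α : ℝ) * k / d) : ℂ) * 𝓕 F ((k : ℝ) / d) := tsum_mul_left

/-! ### Functions of two variables supported in a box: slices -/

section Slices

variable {Φ : ℝ → ℝ → ℂ} {R : ℝ}

/-- Box support: `Φ(t₁, t₂) = 0` unless `|t₁| ≤ R` and `|t₂| ≤ R`. [folklore] -/
def BoxSupport (Φ : ℝ → ℝ → ℂ) (R : ℝ) : Prop := ∀ t₁ t₂, Φ t₁ t₂ ≠ 0 → |t₁| ≤ R ∧ |t₂| ≤ R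

/-- The `t₂`-slices have compact support. [folklore] -/
theorem BoxSupport.hasCompactSupport_right (h : BoxSupport Φ R) (t₁ : ℝ) : HasCompactSupport (Φ t₁) := by
  refine HasCompactSupport.intro (isCompact_Icc (a := -R) (b := R)) fun t₂ ht₂ => ?_
  by_contra hne
  exact ht₂ (mem_Icc.mpr (abs_le.mp (h t₁ t₂ hne).2))

/-- The `t₁`-slices have compact support. [folklore] -/
theorem BoxSupport.hasCompactSupport_left (h : BoxSupport Φ R) (t₂ : ℝ) :
    HasCompactSupport (fun t₁ => Φ t₁ t₂) := by
  refine HasCompactSupport.intro (isCompact_Icc (a := -R) (b := R)) fun t₁ ht₁ => ?_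
  by_contra hne
  exact ht₁ (mem_Icc.mpr (abs_le.mp (h t₁ t₂ hne).1))

/-- The function of two variables has compact support. [folklore] -/
theorem BoxSupport.hasCompactSupport_uncurry (h : BoxSupport Φ R) :
    HasCompactSupport (Function.uncurry Φ) := by
  refine HasCompactSupport.intro ((isCompact_Icc (a := -R) (b := R)).prod (isCompact_Icc (a := -R) (b := R)))
    fun p hp => ?_
  by_contra hne
  obtain ⟨h1, h2⟩ := h p.1 p.2 hne
  exact hp ⟨mem_Icc.mpr (abs_le.mp h1), mem_Icc.mpr (abs_le.mp h2)⟩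

/-- Outside `|t₁| ≤ R` the `t₂`-slice vanishes identically. [folklore] -/
theorem BoxSupport.slice_eq_zero (h : BoxSupport Φ R) {t₁ : ℝ} (ht₁ : R < |t₁|) : Φ t₁ = 0 := by
  funext t₂
  by_contra hne
  exact absurd (h t₁ t₂ hne).1 (not_le.mpr ht₁)

end Slices

/-! ### The iterated Fourier transform -/

/-- The Fourier kernel `e(-v w) = exp(-2πi v w)` as a complex number. [folklore] -/
def ker (v w : ℝ) : ℂ := Complex.exp (↑(-2 * π * v * w) * Complex.I)

/-- `|e(-v w)| = 1`. [folklore] -/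
theorem norm_ker (v w : ℝ) : ‖ker v w‖ = 1 := by
  rw [ker, Complex.norm_exp_ofReal_mul_I]

/-- The kernel is jointly continuous. [folklore] -/
theorem continuous_ker : Continuous fun p : ℝ × ℝ => ker p.1 p.2 := by
  unfold ker
  fun_prop

/-- Mathlib's Fourier transform with the kernel written out: `𝓕 f w = ∫ e(-v w) f(v) dv`. [folklore] -/
theorem fourier_eq_integral_ker (f : ℝ → ℂ) (w : ℝ) : 𝓕 f w = ∫ v, ker v w * f v := by
  rw [Real.fourier_real_eq_integral_exp_smul]
  rfl

/-- The inner transform `Ψ_{ξ₂}(t₁) = 𝓕(Φ(t₁, ·))(ξ₂) = ∫ Φ(t₁, t₂) e(-t₂ ξ₂) dt₂`. [folklore] -/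
def sliceFourier (Φ : ℝ → ℝ → ℂ) (ξ₂ t₁ : ℝ) : ℂ := 𝓕 (Φ t₁) ξ₂

/-- The two-dimensional Fourier transform, as an iterated transform:
`Φ̂(ξ₁, ξ₂) = ∫ e(-t₁ ξ₁) ∫ Φ(t₁, t₂) e(-t₂ ξ₂) dt₂ dt₁`. [folklore] -/
def fourier2 (Φ : ℝ → ℝ → ℂ) (ξ₁ ξ₂ : ℝ) : ℂ := 𝓕 (sliceFourier Φ ξ₂) ξ₁

section Fourier2

variable {Φ : ℝ → ℝ → ℂ} {R : ℝ}

/-- `Ψ_{ξ₂}` as a set integral over `[-R, R]`. [folklore] -/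
theorem sliceFourier_eq_setIntegral (h : BoxSupport Φ R) (ξ₂ t₁ : ℝ) :
    sliceFourier Φ ξ₂ t₁ = ∫ t₂ in Icc (-R) R, ker t₂ ξ₂ * Φ t₁ t₂ := by
  rw [sliceFourier, fourier_eq_integral_ker]
  refine (setIntegral_eq_integral_of_forall_compl_eq_zero fun t₂ ht₂ => ?_).symm
  have : Φ t₁ t₂ = 0 := by
    by_contra hne
    exact ht₂ (mem_Icc.mpr (abs_le.mp (h t₁ t₂ hne).2))
  rw [this, mul_zero]

/-- `Ψ_{ξ₂}` is continuous in `t₁`. [folklore] -/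
theorem continuous_sliceFourier (h : BoxSupport Φ R) (hc : Continuous (Function.uncurry Φ)) (ξ₂ : ℝ) :
    Continuous (sliceFourier Φ ξ₂) := by
  have e : sliceFourier Φ ξ₂ = fun t₁ => ∫ t₂ in Icc (-R) R, ker t₂ ξ₂ * Φ t₁ t₂ := by
    funext t₁; exact sliceFourier_eq_setIntegral h ξ₂ t₁
  rw [e]
  refine continuous_parametric_integral_of_continuous (f := fun t₁ t₂ => ker t₂ ξ₂ * Φ t₁ t₂)
    ?_ isCompact_Icc
  have h1 : Continuous fun p : ℝ × ℝ => ker p.2 ξ₂ :=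
    continuous_ker.comp (continuous_snd.prodMk continuous_const)
  exact h1.mul hc

/-- `Ψ_{ξ₂}` vanishes for `|t₁| > R`. [folklore] -/
theorem sliceFourier_eq_zero (h : BoxSupport Φ R) (ξ₂ : ℝ) {t₁ : ℝ} (ht₁ : R < |t₁|) :
    sliceFourier Φ ξ₂ t₁ = 0 := by
  rw [sliceFourier, h.slice_eq_zero ht₁]
  simp [fourier_eq_integral_ker]

/-- `Ψ_{ξ₂}` has compact support. [folklore] -/
theorem hasCompactSupport_sliceFourier (h : BoxSupport Φ R) (ξ₂ : ℝ) :
    HasCompactSupport (sliceFourier Φ ξ₂) := by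
  refine HasCompactSupport.intro (isCompact_Icc (a := -R) (b := R)) fun t₁ ht₁ => ?_
  refine sliceFourier_eq_zero h ξ₂ ?_
  by_contra hle
  exact ht₁ (mem_Icc.mpr (abs_le.mp (not_lt.mp hle)))

/-- **Fubini**: `Φ̂(ξ₁, ξ₂) = ∫ e(-t₂ ξ₂) 𝓕(Φ(·, t₂))(ξ₁) dt₂`. [folklore] -/
theorem fourier2_eq_swap (h : BoxSupport Φ R) (hc : Continuous (Function.uncurry Φ)) (ξ₁ ξ₂ : ℝ) :
    fourier2 Φ ξ₁ ξ₂ = ∫ t₂, ker t₂ ξ₂ * 𝓕 (fun t₁ => Φ t₁ t₂) ξ₁ := by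
  rw [fourier2, fourier_eq_integral_ker]
  simp_rw [sliceFourier, fourier_eq_integral_ker]
  set f : ℝ → ℝ → ℂ := fun t₁ t₂ => ker t₁ ξ₁ * (ker t₂ ξ₂ * Φ t₁ t₂) with hf
  have hfc : Continuous (Function.uncurry f) := by
    have h1 : Continuous fun p : ℝ × ℝ => ker p.1 ξ₁ :=
      continuous_ker.comp (continuous_fst.prodMk continuous_const)
    have h2 : Continuous fun p : ℝ × ℝ => ker p.2 ξ₂ :=
      continuous_ker.comp (continuous_snd.prodMk continuous_const)
    exact h1.mul (h2.mul hc)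
  have hfs : HasCompactSupport (Function.uncurry f) := by
    refine HasCompactSupport.intro ((isCompact_Icc (a := -R) (b := R)).prod (isCompact_Icc (a := -R) (b := R)))
      fun p hp => ?_
    have : Φ p.1 p.2 = 0 := by
      by_contra hne
      obtain ⟨h1, h2⟩ := h p.1 p.2 hne
      exact hp ⟨mem_Icc.mpr (abs_le.mp h1), mem_Icc.mpr (abs_le.mp h2)⟩
    simp [Function.uncurry, hf, this]
  have hswap := integral_integral_swap_of_hasCompactSupport hfc hfs (μ := volume) (ν := volume)
  calc ∫ t₁, ker t₁ ξ₁ * ∫ t₂, ker t₂ ξ₂ * Φ t₁ t₂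
      = ∫ t₁, ∫ t₂, f t₁ t₂ := by
        refine integral_congr_ae (Eventually.of_forall fun t₁ => ?_)
        rw [hf]; dsimp only
        rw [integral_const_mul]
    _ = ∫ t₂, ∫ t₁, f t₁ t₂ := hswap
    _ = ∫ t₂, ker t₂ ξ₂ * ∫ t₁, ker t₁ ξ₁ * Φ t₁ t₂ := by
        refine integral_congr_ae (Eventually.of_forall fun t₂ => ?_)
        rw [hf]; dsimp only
        rw [← integral_const_mul]
        refine integral_congr_ae (Eventually.of_forall fun t₁ => ?_)
        ring

/-- **Decay of `Φ̂` in `ξ₁`** by two partial integrations in `t₁` under the integral sign: if every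
`t₁`-slice is smooth with `∫ |∂₁² Φ(·, t₂)| ≤ C₁`, then `|Φ̂(ξ₁, ξ₂)| ≤ 2R C₁ / (2π|ξ₁|)²`. [folklore] -/
theorem norm_fourier2_le_of_left (h : BoxSupport Φ R) (hc : Continuous (Function.uncurry Φ)) (hR : 0 ≤ R)
    (hs : ∀ t₂, ContDiff ℝ ∞ (fun t₁ => Φ t₁ t₂)) {C₁ : ℝ}
    (hC : ∀ t₂, (∫ t₁, ‖iteratedDeriv 2 (fun t₁ => Φ t₁ t₂) t₁‖) ≤ C₁) {ξ₁ : ℝ} (hξ₁ : ξ₁ ≠ 0) (ξ₂ : ℝ) :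
    ‖fourier2 Φ ξ₁ ξ₂‖ ≤ 2 * R * C₁ / (2 * π * |ξ₁|) ^ 2 := by
  rw [fourier2_eq_swap h hc]
  have hpt : ∀ t₂, ‖ker t₂ ξ₂ * 𝓕 (fun t₁ => Φ t₁ t₂) ξ₁‖ ≤ C₁ / (2 * π * |ξ₁|) ^ 2 := by
    intro t₂
    rw [norm_mul, norm_ker, one_mul]
    exact (norm_fourier_le_div (hs t₂) (h.hasCompactSupport_left t₂) 2 hξ₁).trans
      (div_le_div_of_nonneg_right (hC t₂) (by positivity))
  have hzero : ∀ t₂, t₂ ∉ Icc (-R) R → ker t₂ ξ₂ * 𝓕 (fun t₁ => Φ t₁ t₂) ξ₁ = 0 := by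
    intro t₂ ht₂
    have : (fun t₁ => Φ t₁ t₂) = 0 := by
      funext t₁
      by_contra hne
      exact ht₂ (mem_Icc.mpr (abs_le.mp (h t₁ t₂ hne).2))
    rw [this]
    simp [fourier_eq_integral_ker]
  rw [← setIntegral_eq_integral_of_forall_compl_eq_zero hzero]
  refine (norm_setIntegral_le_of_norm_le_const measure_Icc_lt_top fun t₂ _ => hpt t₂).trans (le_of_eq ?_)
  rw [Real.volume_real_Icc_of_le (by linarith), show R - -R = 2 * R by ring]
  ring

/-- The decay as an `O(|ξ₁|⁻²)` statement for the function `Ψ_{ξ₂}`. [folklore] -/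
theorem fourier_sliceFourier_isBigO (h : BoxSupport Φ R) (hc : Continuous (Function.uncurry Φ)) (hR : 0 ≤ R)
    (hs : ∀ t₂, ContDiff ℝ ∞ (fun t₁ => Φ t₁ t₂)) {C₁ : ℝ}
    (hC : ∀ t₂, (∫ t₁, ‖iteratedDeriv 2 (fun t₁ => Φ t₁ t₂) t₁‖) ≤ C₁) (ξ₂ : ℝ) :
    𝓕 (sliceFourier Φ ξ₂) =O[cocompact ℝ] fun ξ : ℝ => |ξ| ^ (-2 : ℝ) := by
  refine Asymptotics.IsBigO.of_bound (2 * R * C₁ / (2 * π) ^ 2) ?_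
  filter_upwards [(isCompact_singleton (x := (0 : ℝ))).compl_mem_cocompact] with ξ hξ
  have hξ0 : ξ ≠ 0 := fun h => hξ (by simp [h])
  have hξa : 0 < |ξ| := abs_pos.mpr hξ0
  have hb := norm_fourier2_le_of_left h hc hR hs hC hξ0 ξ₂
  rw [fourier2] at hb
  refine hb.trans (le_of_eq ?_)
  rw [Real.norm_eq_abs, abs_of_pos (Real.rpow_pos_of_pos hξa _), Real.rpow_neg hξa.le, Real.rpow_two]
  field_simp

/-! ### Integrability of slice integrals of norms -/

/-- For `Θ` continuous with box support, `t₂ ↦ ∫ |Θ(t₁, t₂)| dt₁` is integrable. [folklore] -/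
theorem integrable_integral_norm_left {Θ : ℝ → ℝ → ℂ} (h : BoxSupport Θ R)
    (hc : Continuous (Function.uncurry Θ)) : Integrable (fun t₂ => ∫ t₁, ‖Θ t₁ t₂‖) := by
  have e : (fun t₂ => ∫ t₁, ‖Θ t₁ t₂‖) = fun t₂ => ∫ t₁ in Icc (-R) R, ‖Θ t₁ t₂‖ := by
    funext t₂
    refine (setIntegral_eq_integral_of_forall_compl_eq_zero fun t₁ ht₁ => ?_).symm
    have : Θ t₁ t₂ = 0 := by
      by_contra hne
      exact ht₁ (mem_Icc.mpr (abs_le.mp (h t₁ t₂ hne).1))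
    rw [this, norm_zero]
  have hcont : Continuous (fun t₂ => ∫ t₁, ‖Θ t₁ t₂‖) := by
    rw [e]
    refine continuous_parametric_integral_of_continuous (f := fun t₂ t₁ => ‖Θ t₁ t₂‖) ?_ isCompact_Icc
    exact (hc.comp (continuous_snd.prodMk continuous_fst)).norm
  have hsupp : HasCompactSupport (fun t₂ => ∫ t₁, ‖Θ t₁ t₂‖) := by
    refine HasCompactSupport.intro (isCompact_Icc (a := -R) (b := R)) fun t₂ ht₂ => ?_
    have : ∀ t₁, Θ t₁ t₂ = 0 := by
      intro t₁
      by_contra hne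
      exact ht₂ (mem_Icc.mpr (abs_le.mp (h t₁ t₂ hne).2))
    simp [this]
  exact hcont.integrable_of_hasCompactSupport hsupp

/-- For `Θ` continuous with box support, `t₁ ↦ ∫ |Θ(t₁, t₂)| dt₂` is integrable. [folklore] -/
theorem integrable_integral_norm_right {Θ : ℝ → ℝ → ℂ} (h : BoxSupport Θ R)
    (hc : Continuous (Function.uncurry Θ)) : Integrable (fun t₁ => ∫ t₂, ‖Θ t₁ t₂‖) := by
  have h' : BoxSupport (fun t₂ t₁ => Θ t₁ t₂) R := fun t₂ t₁ hne => ⟨(h t₁ t₂ hne).2, (h t₁ t₂ hne).1⟩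
  have hc' : Continuous (Function.uncurry fun t₂ t₁ => Θ t₁ t₂) :=
    hc.comp (continuous_snd.prodMk continuous_fst)
  exact integrable_integral_norm_left h' hc'

/-! ### Bounds for `Φ̂` by iterated integrals of derivatives -/

/-- **Trivial bound**: `|Φ̂(ξ₁, ξ₂)| ≤ ∫∫ |Φ|`. [folklore] -/
theorem norm_fourier2_le (h : BoxSupport Φ R) (hc : Continuous (Function.uncurry Φ)) (ξ₁ ξ₂ : ℝ) :
    ‖fourier2 Φ ξ₁ ξ₂‖ ≤ ∫ t₁, ∫ t₂, ‖Φ t₁ t₂‖ := by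
  rw [fourier2]
  refine (norm_fourier_le_integral_norm _ _).trans ?_
  refine integral_mono_of_nonneg (Eventually.of_forall fun t₁ => norm_nonneg _)
    (integrable_integral_norm_right h hc) (Eventually.of_forall fun t₁ => ?_)
  exact norm_fourier_le_integral_norm _ _

/-- **Two partial integrations in `t₁`** (iterated-integral form): with `∂₁²Φ = Θ₁` jointly
continuous of box support, `|Φ̂(ξ₁, ξ₂)| ≤ (2π|ξ₁|)⁻² ∫∫ |Θ₁|` (`ξ₁ ≠ 0`). [folklore] -/
theorem norm_fourier2_le_left (h : BoxSupport Φ R) (hc : Continuous (Function.uncurry Φ))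
    (hs : ∀ t₂, ContDiff ℝ ∞ (fun t₁ => Φ t₁ t₂)) {Θ₁ : ℝ → ℝ → ℂ}
    (hΘ : ∀ t₂, iteratedDeriv 2 (fun t₁ => Φ t₁ t₂) = fun t₁ => Θ₁ t₁ t₂)
    (hΘs : BoxSupport Θ₁ R) (hΘc : Continuous (Function.uncurry Θ₁)) {ξ₁ : ℝ} (hξ₁ : ξ₁ ≠ 0) (ξ₂ : ℝ) :
    ‖fourier2 Φ ξ₁ ξ₂‖ ≤ ((2 * π * |ξ₁|) ^ 2)⁻¹ * ∫ t₂, ∫ t₁, ‖Θ₁ t₁ t₂‖ := by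
  rw [fourier2_eq_swap h hc]
  refine (norm_integral_le_integral_norm _).trans ?_
  have hpt : ∀ t₂, ‖ker t₂ ξ₂ * 𝓕 (fun t₁ => Φ t₁ t₂) ξ₁‖ ≤
      ((2 * π * |ξ₁|) ^ 2)⁻¹ * ∫ t₁, ‖Θ₁ t₁ t₂‖ := by
    intro t₂
    rw [norm_mul, norm_ker, one_mul]
    have := norm_fourier_le_div (hs t₂) (h.hasCompactSupport_left t₂) 2 hξ₁
    rw [hΘ t₂] at this
    rw [inv_mul_eq_div]
    exact this
  refine (integral_mono_of_nonneg (Eventually.of_forall fun t₂ => norm_nonneg _)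
    ((integrable_integral_norm_left hΘs hΘc).const_mul _) (Eventually.of_forall hpt)).trans (le_of_eq ?_)
  exact integral_const_mul _ _

/-- **Two partial integrations in `t₂`**: with `∂₂²Φ = Θ₂` jointly continuous of box support,
`|Φ̂(ξ₁, ξ₂)| ≤ (2π|ξ₂|)⁻² ∫∫ |Θ₂|` (`ξ₂ ≠ 0`). [folklore] -/
theorem norm_fourier2_le_right (h : BoxSupport Φ R) (hs : ∀ t₁, ContDiff ℝ ∞ (Φ t₁)) {Θ₂ : ℝ → ℝ → ℂ}
    (hΘ : ∀ t₁, iteratedDeriv 2 (Φ t₁) = Θ₂ t₁) (hΘs : BoxSupport Θ₂ R)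
    (hΘc : Continuous (Function.uncurry Θ₂)) (ξ₁ : ℝ) {ξ₂ : ℝ} (hξ₂ : ξ₂ ≠ 0) :
    ‖fourier2 Φ ξ₁ ξ₂‖ ≤ ((2 * π * |ξ₂|) ^ 2)⁻¹ * ∫ t₁, ∫ t₂, ‖Θ₂ t₁ t₂‖ := by
  rw [fourier2]
  refine (norm_fourier_le_integral_norm _ _).trans ?_
  have hpt : ∀ t₁, ‖sliceFourier Φ ξ₂ t₁‖ ≤ ((2 * π * |ξ₂|) ^ 2)⁻¹ * ∫ t₂, ‖Θ₂ t₁ t₂‖ := by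
    intro t₁
    rw [sliceFourier]
    have := norm_fourier_le_div (hs t₁) (h.hasCompactSupport_right t₁) 2 hξ₂
    rw [hΘ t₁] at this
    rw [inv_mul_eq_div]
    exact this
  refine (integral_mono_of_nonneg (Eventually.of_forall fun t₁ => norm_nonneg _)
    ((integrable_integral_norm_right hΘs hΘc).const_mul _) (Eventually.of_forall hpt)).trans (le_of_eq ?_)
  exact integral_const_mul _ _

/-- Partial integration in `t₂` inside the slice transform: `Ψ^Φ_{ξ₂} = (2πiξ₂)⁻² Ψ^{∂₂²Φ}_{ξ₂}`.
[folklore] -/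
theorem sliceFourier_eq_of_deriv (h : BoxSupport Φ R) (hs : ∀ t₁, ContDiff ℝ ∞ (Φ t₁))
    {Θ₂ : ℝ → ℝ → ℂ} (hΘ : ∀ t₁, iteratedDeriv 2 (Φ t₁) = Θ₂ t₁) {ξ₂ : ℝ} (hξ₂ : ξ₂ ≠ 0) (t₁ : ℝ) :
    sliceFourier Φ ξ₂ t₁ = ((2 * π * I * ξ₂) ^ 2)⁻¹ * sliceFourier Θ₂ ξ₂ t₁ := by
  have hF := Real.fourier_iteratedDeriv (N := (⊤ : ℕ∞)) (n := 2) (hs t₁)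
    (fun m _ => integrable_iteratedDeriv (hs t₁) (h.hasCompactSupport_right t₁) m) (by exact_mod_cast le_top)
  have hF' := congrFun hF ξ₂
  rw [hΘ t₁] at hF'
  rw [sliceFourier, sliceFourier, hF', smul_eq_mul, ← mul_assoc, inv_mul_cancel₀, one_mul]
  have : (2 * π * I * ξ₂) ≠ 0 := by
    have hπ : (π : ℂ) ≠ 0 := by exact_mod_cast Real.pi_ne_zero
    have hξ : (ξ₂ : ℂ) ≠ 0 := by exact_mod_cast hξ₂
    simp [hπ, hξ, I_ne_zero]
  exact pow_ne_zero 2 this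

/-- `Φ̂ = (2πiξ₂)⁻² (∂₂²Φ)^`. [folklore] -/
theorem fourier2_eq_of_deriv (h : BoxSupport Φ R) (hs : ∀ t₁, ContDiff ℝ ∞ (Φ t₁))
    {Θ₂ : ℝ → ℝ → ℂ} (hΘ : ∀ t₁, iteratedDeriv 2 (Φ t₁) = Θ₂ t₁) (ξ₁ : ℝ) {ξ₂ : ℝ} (hξ₂ : ξ₂ ≠ 0) :
    fourier2 Φ ξ₁ ξ₂ = ((2 * π * I * ξ₂) ^ 2)⁻¹ * fourier2 Θ₂ ξ₁ ξ₂ := by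
  rw [fourier2, fourier2, fourier_eq_integral_ker, fourier_eq_integral_ker, ← integral_const_mul]
  refine integral_congr_ae (Eventually.of_forall fun t₁ => ?_)
  dsimp only
  rw [sliceFourier_eq_of_deriv h hs hΘ hξ₂]
  ring

/-- **Two partial integrations in each variable**: with `∂₂²Φ = Θ₂` and `∂₁²Θ₂ = Θ₂₁`, all jointly
continuous of box support, `|Φ̂(ξ₁, ξ₂)| ≤ (2π|ξ₁|)⁻² (2π|ξ₂|)⁻² ∫∫ |Θ₂₁|` (`ξ₁ ξ₂ ≠ 0`). [folklore] -/
theorem norm_fourier2_le_mixed (h : BoxSupport Φ R) (hs₂ : ∀ t₁, ContDiff ℝ ∞ (Φ t₁))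
    {Θ₂ : ℝ → ℝ → ℂ} (hΘ₂ : ∀ t₁, iteratedDeriv 2 (Φ t₁) = Θ₂ t₁) (hΘ₂s : BoxSupport Θ₂ R)
    (hΘ₂c : Continuous (Function.uncurry Θ₂)) (hΘ₂d : ∀ t₂, ContDiff ℝ ∞ (fun t₁ => Θ₂ t₁ t₂))
    {Θ₂₁ : ℝ → ℝ → ℂ} (hΘ₂₁ : ∀ t₂, iteratedDeriv 2 (fun t₁ => Θ₂ t₁ t₂) = fun t₁ => Θ₂₁ t₁ t₂)
    (hΘ₂₁s : BoxSupport Θ₂₁ R) (hΘ₂₁c : Continuous (Function.uncurry Θ₂₁))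
    {ξ₁ ξ₂ : ℝ} (hξ₁ : ξ₁ ≠ 0) (hξ₂ : ξ₂ ≠ 0) :
    ‖fourier2 Φ ξ₁ ξ₂‖ ≤ ((2 * π * |ξ₁|) ^ 2)⁻¹ * ((2 * π * |ξ₂|) ^ 2)⁻¹ * ∫ t₂, ∫ t₁, ‖Θ₂₁ t₁ t₂‖ := by
  rw [fourier2_eq_of_deriv h hs₂ hΘ₂ ξ₁ hξ₂, norm_mul, norm_inv, norm_pow]
  have e : ‖2 * (π : ℂ) * I * ξ₂‖ = 2 * π * |ξ₂| := by
    rw [norm_mul, norm_mul, norm_mul, Complex.norm_I, mul_one, Complex.norm_real, Complex.norm_real,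
      Real.norm_eq_abs, Real.norm_eq_abs, abs_of_pos Real.pi_pos]
    simp
  rw [e]
  have hb := norm_fourier2_le_left hΘ₂s hΘ₂c hΘ₂d hΘ₂₁ hΘ₂₁s hΘ₂₁c hξ₁ ξ₂
  calc ((2 * π * |ξ₂|) ^ 2)⁻¹ * ‖fourier2 Θ₂ ξ₁ ξ₂‖
      ≤ ((2 * π * |ξ₂|) ^ 2)⁻¹ * (((2 * π * |ξ₁|) ^ 2)⁻¹ * ∫ t₂, ∫ t₁, ‖Θ₂₁ t₁ t₂‖) :=
        mul_le_mul_of_nonneg_left hb (by positivity)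
    _ = _ := by ring

/-! ### Summability and the two-dimensional Poisson formula -/

/-- `k ↦ 𝓕F(k/d)` is summable over `ℤ` when `𝓕F = O(|ξ|⁻²)`. [folklore] -/
theorem summable_fourier_div_of_decay {F : ℝ → ℂ}
    (hdec : 𝓕 F =O[cocompact ℝ] fun ξ : ℝ => |ξ| ^ (-2 : ℝ)) {d : ℝ} (hd : 0 < d) :
    Summable fun k : ℤ => 𝓕 F ((k : ℝ) / d) := by
  refine summable_of_isBigO (Real.summable_abs_int_rpow one_lt_two) ?_
  have h1 : Tendsto (fun k : ℤ => (k : ℝ) / d) cofinite (cocompact ℝ) :=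
    (tendsto_div_const_cocompact hd).comp Int.tendsto_coe_cofinite
  have h2 := hdec.comp_tendsto h1
  refine h2.trans ?_
  refine Asymptotics.IsBigO.of_bound (d ^ 2) ?_
  have hmem : {k : ℤ | k ≤ -1 ∨ 1 ≤ k} ∈ (cofinite : Filter ℤ) := by
    rw [Int.cofinite_eq, Filter.mem_sup]
    exact ⟨Filter.mem_of_superset (Filter.mem_atBot (-1)) fun k hk => Or.inl hk,
      Filter.mem_of_superset (Filter.mem_atTop 1) fun k hk => Or.inr hk⟩
  filter_upwards [hmem] with k hk
  have hk0 : 0 < |(k : ℝ)| := by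
    rcases hk with h | h
    · have : (k : ℝ) ≤ -1 := by exact_mod_cast h
      rw [abs_pos]; intro h0; linarith
    · have : (1 : ℝ) ≤ k := by exact_mod_cast h
      rw [abs_pos]; intro h0; linarith
  have hkd : 0 < |(k : ℝ) / d| := by rw [abs_div, abs_of_pos hd]; exact div_pos hk0 hd
  simp only [Function.comp_apply]
  rw [Real.norm_eq_abs, Real.norm_eq_abs, abs_of_pos (Real.rpow_pos_of_pos hkd _),
    abs_of_pos (Real.rpow_pos_of_pos hk0 _), abs_div, abs_of_pos hd, Real.div_rpow hk0.le hd.le,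
    Real.rpow_neg hd.le, Real.rpow_two]
  rw [div_eq_mul_inv, inv_inv, mul_comm]

/-- The `m₁` outside a finite range contribute nothing: for `|m₁| > R + |γ₁|` (and `D ≥ 1`) the
point `γ₁ + D m₁` lies outside `[-R, R]`. [folklore] -/
theorem abs_gt_of_not_mem_Icc {R : ℝ} {D : ℕ} (hD : 0 < D) (γ₁ : ℤ) {m₁ : ℤ}
    (hm : m₁ ∉ Finset.Icc (-((⌈R⌉₊ + γ₁.natAbs : ℕ) : ℤ)) ((⌈R⌉₊ + γ₁.natAbs : ℕ) : ℤ)) :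
    R < |((γ₁ : ℝ) + D * m₁)| := by
  set B : ℕ := ⌈R⌉₊ + γ₁.natAbs with hB
  rw [Finset.mem_Icc, not_and_or, not_le, not_le] at hm
  have hD1 : (1 : ℝ) ≤ D := by exact_mod_cast hD
  have hR : R ≤ ⌈R⌉₊ := Nat.le_ceil R
  have hγ : |(γ₁ : ℝ)| = (γ₁.natAbs : ℝ) := by
    rw [Nat.cast_natAbs, Int.cast_abs]
  have hBR : (B : ℝ) = ⌈R⌉₊ + |(γ₁ : ℝ)| := by rw [hB, hγ]; push_cast; ring
  have hm' : (B : ℝ) + 1 ≤ |(m₁ : ℝ)| := by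
    rcases hm with h | h
    · have h2 : m₁ + 1 ≤ -(B : ℤ) := by omega
      have h3 : (m₁ : ℝ) + 1 ≤ -(B : ℝ) := by exact_mod_cast h2
      rw [abs_of_neg (by linarith)]; linarith
    · have h2 : (B : ℤ) + 1 ≤ m₁ := by omega
      have h3 : (B : ℝ) + 1 ≤ (m₁ : ℝ) := by exact_mod_cast h2
      rw [abs_of_pos (by linarith)]; linarith
  have h1 : |(D : ℝ) * m₁| - |(γ₁ : ℝ)| ≤ |(γ₁ : ℝ) + D * m₁| := by
    have := abs_sub_abs_le_abs_sub ((D : ℝ) * m₁) (-(γ₁ : ℝ))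
    rw [abs_neg, sub_neg_eq_add, add_comm ((D : ℝ) * m₁)] at this
    exact this
  have h2 : |(m₁ : ℝ)| ≤ |(D : ℝ) * m₁| := by
    rw [abs_mul, abs_of_pos (by linarith : (0 : ℝ) < D)]
    exact le_mul_of_one_le_left (abs_nonneg _) hD1
  linarith

/-- **Poisson summation in two variables along a lattice coset** (iterated form). For `Φ`
continuous of box support with smooth slices and `∫ |∂₁²Φ(·, t₂)| dt₁ ≤ C₁` uniformly, `D ≥ 1` and
`γ₁, γ₂ ∈ ℤ`:
`Σ_{m₁} Σ_{m₂} Φ(γ₁ + Dm₁, γ₂ + Dm₂) = D⁻² Σ_{k₂} Σ_{k₁} e((γ₁k₁ + γ₂k₂)/D) Φ̂(k₁/D, k₂/D)`.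
This is the step "(6.7) ⇒ (6.9)" of the source ("for each pair of classes we execute the
summation by Poisson's formula obtaining … the Fourier series").
[cite: FriedlanderIwaniecAnnals1998, (6.8)-(6.9)] -/
theorem tsum_tsum_arithProg₂ (h : BoxSupport Φ R) (hc : Continuous (Function.uncurry Φ)) (hR : 0 ≤ R)
    (hs₁ : ∀ t₂, ContDiff ℝ ∞ (fun t₁ => Φ t₁ t₂)) (hs₂ : ∀ t₁, ContDiff ℝ ∞ (Φ t₁))
    {C₁ : ℝ} (hC : ∀ t₂, (∫ t₁, ‖iteratedDeriv 2 (fun t₁ => Φ t₁ t₂) t₁‖) ≤ C₁)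
    {D : ℕ} (hD : 0 < D) (γ₁ γ₂ : ℤ) :
    ∑' m₁ : ℤ, ∑' m₂ : ℤ, Φ (γ₁ + D * m₁) (γ₂ + D * m₂) =
      ((D : ℂ)⁻¹) ^ 2 * ∑' k₂ : ℤ, ∑' k₁ : ℤ,
        (𝐞 ((γ₁ : ℝ) * k₁ / D) : ℂ) * (𝐞 ((γ₂ : ℝ) * k₂ / D) : ℂ) * fourier2 Φ (k₁ / D) (k₂ / D) := by
  have hDr : (0 : ℝ) < D := by exact_mod_cast hD
  -- Step 1: Poisson in `m₂` for each `m₁`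
  have step1 : ∀ m₁ : ℤ, ∑' m₂ : ℤ, Φ (γ₁ + D * m₁) (γ₂ + D * m₂) =
      (D : ℂ)⁻¹ * ∑' k₂ : ℤ, (𝐞 ((γ₂ : ℝ) * k₂ / D) : ℂ) * sliceFourier Φ (k₂ / D) (γ₁ + D * m₁) := by
    intro m₁
    exact tsum_arithProg_eq_tsum_fourier (hs₂ _) (h.hasCompactSupport_right _) hD γ₂
  simp_rw [step1]
  rw [tsum_mul_left]
  -- Step 2: the `m₁`-sum is finite; interchange
  set S : Finset ℤ := Finset.Icc (-((⌈R⌉₊ + γ₁.natAbs : ℕ) : ℤ)) ((⌈R⌉₊ + γ₁.natAbs : ℕ) : ℤ) with hS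
  have hout : ∀ m₁ ∉ S, ∀ ξ₂, sliceFourier Φ ξ₂ (γ₁ + D * m₁) = 0 := fun m₁ hm ξ₂ =>
    sliceFourier_eq_zero h ξ₂ (abs_gt_of_not_mem_Icc hD γ₁ hm)
  have hsum : ∀ m₁ : ℤ, Summable fun k₂ : ℤ =>
      (𝐞 ((γ₂ : ℝ) * k₂ / D) : ℂ) * sliceFourier Φ (k₂ / D) (γ₁ + D * m₁) := by
    intro m₁
    have hsm := (summable_fourier_div (hs₂ ((γ₁ : ℝ) + D * m₁)) (h.hasCompactSupport_right _) hDr).norm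
    refine Summable.of_norm_bounded hsm (fun k₂ => ?_)
    rw [norm_mul, Circle.norm_coe, one_mul, sliceFourier]
  have step2 : ∑' m₁ : ℤ, ∑' k₂ : ℤ, (𝐞 ((γ₂ : ℝ) * k₂ / D) : ℂ) * sliceFourier Φ (k₂ / D) (γ₁ + D * m₁) =
      ∑' k₂ : ℤ, (𝐞 ((γ₂ : ℝ) * k₂ / D) : ℂ) * ∑' m₁ : ℤ, sliceFourier Φ (k₂ / D) (γ₁ + D * m₁) := by
    have hzero : ∀ m₁ ∉ S, (∑' k₂ : ℤ, (𝐞 ((γ₂ : ℝ) * k₂ / D) : ℂ) *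
        sliceFourier Φ (k₂ / D) (γ₁ + D * m₁)) = 0 := by
      intro m₁ hm; simp [hout m₁ hm]
    have hzero' : ∀ k₂ : ℤ, ∀ m₁ ∉ S, sliceFourier Φ (k₂ / D) (γ₁ + D * m₁) = 0 :=
      fun k₂ m₁ hm => hout m₁ hm _
    rw [tsum_eq_sum hzero, ← Summable.tsum_finsetSum (fun m₁ _ => hsum m₁)]
    refine tsum_congr fun k₂ => ?_
    rw [← Finset.mul_sum, tsum_eq_sum (hzero' k₂)]
  rw [step2]
  -- Step 3: Poisson in `m₁` for each `k₂`
  have step3 : ∀ k₂ : ℤ, ∑' m₁ : ℤ, sliceFourier Φ (k₂ / D) (γ₁ + D * m₁) =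
      (D : ℂ)⁻¹ * ∑' k₁ : ℤ, (𝐞 ((γ₁ : ℝ) * k₁ / D) : ℂ) * fourier2 Φ (k₁ / D) (k₂ / D) := by
    intro k₂
    exact tsum_arithProg_eq_tsum_fourier_of_decay (continuous_sliceFourier h hc _)
      (hasCompactSupport_sliceFourier h _) (fourier_sliceFourier_isBigO h hc hR hs₁ hC _) hD γ₁
  simp_rw [step3]
  -- Step 4: constants
  set e₁ : ℤ → ℂ := fun k₁ => (𝐞 ((γ₁ : ℝ) * k₁ / D) : ℂ) with he₁
  set e₂ : ℤ → ℂ := fun k₂ => (𝐞 ((γ₂ : ℝ) * k₂ / D) : ℂ) with he₂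
  set F : ℤ → ℤ → ℂ := fun k₁ k₂ => fourier2 Φ (k₁ / D) (k₂ / D) with hF
  have inner : ∀ k₂ : ℤ, ∑' k₁ : ℤ, e₁ k₁ * e₂ k₂ * F k₁ k₂ = e₂ k₂ * ∑' k₁ : ℤ, e₁ k₁ * F k₁ k₂ := by
    intro k₂
    rw [show (fun k₁ : ℤ => e₁ k₁ * e₂ k₂ * F k₁ k₂) = fun k₁ : ℤ => e₂ k₂ * (e₁ k₁ * F k₁ k₂) by
      funext k₁; ring]
    exact tsum_mul_left
  show (D : ℂ)⁻¹ * ∑' k₂ : ℤ, e₂ k₂ * ((D : ℂ)⁻¹ * ∑' k₁ : ℤ, e₁ k₁ * F k₁ k₂) =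
    ((D : ℂ)⁻¹) ^ 2 * ∑' k₂ : ℤ, ∑' k₁ : ℤ, e₁ k₁ * e₂ k₂ * F k₁ k₂
  simp_rw [inner]
  rw [show ((D : ℂ)⁻¹) ^ 2 = (D : ℂ)⁻¹ * (D : ℂ)⁻¹ by ring, mul_assoc]
  congr 1
  rw [show (fun k₂ : ℤ => e₂ k₂ * ((D : ℂ)⁻¹ * ∑' k₁ : ℤ, e₁ k₁ * F k₁ k₂)) =
      fun k₂ : ℤ => (D : ℂ)⁻¹ * (e₂ k₂ * ∑' k₁ : ℤ, e₁ k₁ * F k₁ k₂) by funext k₂; ring]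
  exact tsum_mul_left

end Fourier2

/-! ### Splitting off the zero frequency in a double series -/

/-- **The zero frequency and the rest.** For a double series `a(k₁, k₂)` dominated off the origin by
a non-negative `c(k₁, k₂)` which is summable in the iterated sense,
`|Σ_{k₂} Σ_{k₁} a(k₁, k₂) - a(0, 0)| ≤ Σ_{k₂} Σ_{k₁} [(k₁, k₂) ≠ 0] c(k₁, k₂)`. [folklore] -/
theorem norm_tsum_tsum_sub_le {a : ℤ → ℤ → ℂ} {c : ℤ → ℤ → ℝ} (hc0 : ∀ k₁ k₂, 0 ≤ c k₁ k₂)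
    (hac : ∀ k₁ k₂, ¬ (k₁ = 0 ∧ k₂ = 0) → ‖a k₁ k₂‖ ≤ c k₁ k₂)
    (hcs₁ : ∀ k₂, Summable fun k₁ => c k₁ k₂) (hcs₂ : Summable fun k₂ => ∑' k₁, c k₁ k₂)
    (has₂ : Summable fun k₂ => ∑' k₁, a k₁ k₂) :
    ‖(∑' k₂, ∑' k₁, a k₁ k₂) - a 0 0‖ ≤
      ∑' k₂, ∑' k₁, (if k₁ = 0 ∧ k₂ = 0 then 0 else c k₁ k₂) := by
  classical
  set a' : ℤ → ℤ → ℂ := fun k₁ k₂ => if k₁ = 0 ∧ k₂ = 0 then 0 else a k₁ k₂ with ha'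
  set c' : ℤ → ℤ → ℝ := fun k₁ k₂ => if k₁ = 0 ∧ k₂ = 0 then 0 else c k₁ k₂ with hc'
  set δ : ℤ → ℤ → ℂ := fun k₁ k₂ => if k₁ = 0 ∧ k₂ = 0 then a 0 0 else 0 with hδ
  have hsplit : ∀ k₁ k₂, a k₁ k₂ = a' k₁ k₂ + δ k₁ k₂ := by
    intro k₁ k₂
    rw [ha', hδ]; dsimp only
    by_cases h : k₁ = 0 ∧ k₂ = 0
    · rw [if_pos h, if_pos h, h.1, h.2, zero_add]
    · rw [if_neg h, if_neg h, add_zero]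
  have hc'0 : ∀ k₁ k₂, 0 ≤ c' k₁ k₂ := by
    intro k₁ k₂; rw [hc']; dsimp only; split_ifs
    · exact le_rfl
    · exact hc0 k₁ k₂
  have hc'le : ∀ k₁ k₂, c' k₁ k₂ ≤ c k₁ k₂ := by
    intro k₁ k₂; rw [hc']; dsimp only; split_ifs
    · exact hc0 k₁ k₂
    · exact le_rfl
  have ha'c' : ∀ k₁ k₂, ‖a' k₁ k₂‖ ≤ c' k₁ k₂ := by
    intro k₁ k₂; rw [ha', hc']; dsimp only
    by_cases h : k₁ = 0 ∧ k₂ = 0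
    · rw [if_pos h, if_pos h, norm_zero]
    · rw [if_neg h, if_neg h]; exact hac k₁ k₂ h
  -- the `δ` series
  have hδ₁ : ∀ k₂, ∑' k₁, δ k₁ k₂ = if k₂ = 0 then a 0 0 else 0 := by
    intro k₂
    by_cases hk₂ : k₂ = 0
    · rw [if_pos hk₂]
      have : (fun k₁ => δ k₁ k₂) = fun k₁ => if k₁ = 0 then a 0 0 else 0 := by
        funext k₁; rw [hδ]; dsimp only; simp [hk₂]
      rw [this, tsum_ite_eq]
    · rw [if_neg hk₂]
      have : (fun k₁ => δ k₁ k₂) = fun _ => 0 := by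
        funext k₁; rw [hδ]; dsimp only; simp [hk₂]
      rw [this, tsum_zero]
  have hδs₁ : ∀ k₂, Summable fun k₁ => δ k₁ k₂ := by
    intro k₂
    refine summable_of_ne_finset_zero (s := {0}) fun k₁ hk₁ => ?_
    rw [Finset.mem_singleton] at hk₁
    rw [hδ]; dsimp only; simp [hk₁]
  have hδ₂ : ∑' k₂, ∑' k₁, δ k₁ k₂ = a 0 0 := by
    simp_rw [hδ₁]; rw [tsum_ite_eq]
  have hδs₂ : Summable fun k₂ => ∑' k₁, δ k₁ k₂ := by
    simp_rw [hδ₁]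
    refine summable_of_ne_finset_zero (s := {0}) fun k₂ hk₂ => ?_
    rw [Finset.mem_singleton] at hk₂
    simp [hk₂]
  -- summability of `a'`, `c'`
  have hc's₁ : ∀ k₂, Summable fun k₁ => c' k₁ k₂ := fun k₂ =>
    (hcs₁ k₂).of_nonneg_of_le (fun k₁ => hc'0 k₁ k₂) (fun k₁ => hc'le k₁ k₂)
  have ha's₁ : ∀ k₂, Summable fun k₁ => a' k₁ k₂ := fun k₂ =>
    Summable.of_norm_bounded (hc's₁ k₂) (fun k₁ => ha'c' k₁ k₂)
  have ha'eq : ∀ k₂, ∑' k₁, a' k₁ k₂ = (∑' k₁, a k₁ k₂) - ∑' k₁, δ k₁ k₂ := by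
    intro k₂
    rw [eq_sub_iff_add_eq, ← (ha's₁ k₂).tsum_add (hδs₁ k₂)]
    exact tsum_congr fun k₁ => (hsplit k₁ k₂).symm
  have ha's₂ : Summable fun k₂ => ∑' k₁, a' k₁ k₂ := by
    simp_rw [ha'eq]; exact has₂.sub hδs₂
  have hmain : (∑' k₂, ∑' k₁, a k₁ k₂) - a 0 0 = ∑' k₂, ∑' k₁, a' k₁ k₂ := by
    rw [← hδ₂, ← has₂.tsum_sub hδs₂]
    exact tsum_congr fun k₂ => (ha'eq k₂).symm
  rw [hmain]
  -- norms
  have hn₁ : ∀ k₂, ‖∑' k₁, a' k₁ k₂‖ ≤ ∑' k₁, c' k₁ k₂ := fun k₂ =>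
    tsum_of_norm_bounded (hc's₁ k₂).hasSum (fun k₁ => ha'c' k₁ k₂)
  have hc's₂ : Summable fun k₂ => ∑' k₁, c' k₁ k₂ :=
    hcs₂.of_nonneg_of_le (fun k₂ => tsum_nonneg fun k₁ => hc'0 k₁ k₂)
      (fun k₂ => (hc's₁ k₂).tsum_le_tsum (fun k₁ => hc'le k₁ k₂) (hcs₁ k₂))
  exact tsum_of_norm_bounded hc's₂.hasSum hn₁

end Literature.NumberTheory.Sieve.FriedlanderIwaniecPrimes
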